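import Literature.InformationTheory.QuantumCodes.LiftedProductSwap
import Literature.InformationTheory.QuantumCodes.HypergraphProduct
import Literature.InformationTheory.Coding.DualDistance
import Mathlib.LinearAlgebra.Matrix.Circulant
import HarnessLib

/-!
# The distance of quasi-abelian lifted-product codes: `d ≥ ⌈min(d_A^⊥, d_B^⊥)/c⌉` (Lin–Pryadko 2024 Statement 12
# = Kovalev–Pryadko 2013 Theorem 5) — proof

Topic `InformationTheory/QuantumCodes`; namespace `Literature.InformationTheory.QuantumCodes.LiftedProduct`. LADDER-QEC
(cell `qec`), LIT-3 constructions (register T4 / KP13 Thm 5): the first lifted-product distance LOWER bound in the tree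
beyond the hypergraph product (`HypergraphProductDistance.lean`, Tillich–Zémor Thm 9, which is the case `c = 1` below).

## Sources (read on the page)

* H.-K. Lin, L. P. Pryadko, *Quantum two-block group algebra codes*, PRA **109** (2024) 022407 = arXiv:2306.16400
  [LinPryadko2024]. **Statement 12** (chunk p0011 L101–110, «Version of Theorem 5 from Ref. [Kovalev-Pryadko-
  Hyperbicycle-2013]»): «Given elements `a,b ∈ F[G]` such that the intersection subgroup `N ≡ G_a ∩ G_b` of rank `c`
  is abelian and normal in both support groups, let `d_A^⊥` and `d_B^⊥` be the distances of classical `F`-linear group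
  algebra codes with parity check matrices `A = 𝕃(a)` and `B = ℝ(b)`. Then the distance `d_Z` of the code `LP[a,b]`
  satisfies `d_Z ≥ d₀ ≡ ⌈min(d_A^⊥, d_B^⊥)/c⌉`.» Proof §VIII.E (chunk p0019 L98 – p0020 L55): the code is «equivalent
  to the `R`-linear code `HP[A₁,B₁]`», `R = F[N]`; given `e` with `H_X e = 0` one restricts to the columns of `A₁`, `B₁`
  incident on `e` (`|ℐ'_μ| = c|ℐ_μ| ≤ c·wgt(e)`), and «if `|ℐ'_A| < d_A^⊥` and `|ℐ'_B| < d_B^⊥`, the modified LP code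
  must be trivial by Lemma 16 [trivial quasi-abelian LP codes], i.e., `e[ℐ]` can only be a trivial codeword … thus
  the full vector `e` is a linear combination of the rows of the original matrix `H_Z`».
* A. A. Kovalev, L. P. Pryadko, *Quantum Kronecker sum-product LDPC codes with finite rate*, PRA **88** (2013) 012311 =
  arXiv:1212.6703 [KovalevPryadko2013Hyperbicycle], **Theorem 5** (chunk p0011 L83–104): «The minimum distance of the
  code with generators (Hyperbicycle) satisfies the lower bound `D ≥ ⌊d/c⌋`, `d ≡ min(d₁, d₂, d̃₁, d̃₂)`», proof by
  the same restriction: «for every non-zero bit of `u`, one of the reduced matrices `ℋ₁'`, `ℋ₂'` may get `c` columns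
  … If we take `wgt(u) < ⌊d/c⌋` … the reduced code encodes no qubits, thus … `u` is also a linear combination of the
  rows of `G_Z`».
* The construction: P. Panteleev, G. Kalachev [PanteleevKalachev2022LP, §III.D–E] — the tree's `LiftedProduct.xMatrix`,
  `zMatrix` (`QuantumCodes/LiftedProduct.lean`) and the `X ↔ Z` symmetry `LP(A,B) ↔ LP(B*,A*)`
  (`QuantumCodes/LiftedProductSwap.lean`).

## What is proved (0 named facts, axioms standard)

Setting: a field `F`, a finite abelian group `N` (`c = |N|`), block matrices `A = (circulant (α i j))`,
`B = (circulant (β s u))` with `N`-circulant blocks (all quasi-abelian LP codes `LP(A,B)` over `F[N]`: GB / BB / abelian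
2BGA codes (`1 × 1` blocks), hypergraph products (`N = 0`), Kovalev–Pryadko hyperbicycle and Panteleev–Kalachev
quasi-cyclic LP codes (`N = ℤ_ℓ`); the qec census objects `LPTyped.lpCode ℓ E es` are literally of this form);
`𝔅(A) = flat α` the flat `F`-matrix.

* `min_minDist_le_card_mul_hammingNorm_of_cycle` — **`Z`-sector**: every `e ∈ ker 𝔅(H_X) ∖ rowsp 𝔅(H_Z)` has
  `min(d(ker 𝔅A), d(ker 𝔅B)) ≤ c · wt(e)`, i.e. `d_Z ≥ ⌈min(d_A^⊥, d_B^⊥)/c⌉` (any characteristic);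
* `min_minDist_le_card_mul_hammingNorm_of_cocycle` — **`X`-sector** (characteristic two, via `LP(B*,A*)`), with the
  transposed flat matrices (`d̃₁, d̃₂` of [KovalevPryadko2013Hyperbicycle]);
* `le_cssMinDist_of_card_mul_lt` — the **distance bound** `D ≤ cssMinDist 𝔅(H_X) 𝔅(H_Z)` for every `D` with
  `c(D−1) < d := min(d_A^⊥, d_B^⊥, d̃_A, d̃_B)`, i.e. `D = ⌈d/c⌉` (characteristic two, the tree's CSS setting).

## The proof, and where it deviates from print

The restriction argument is the printed one (and the tree's TZ proof, `HypergraphProduct.exists_chamber_decomposition`),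
run over `R = F[N]` in flat coordinates: a qubit vector `e` is a pair of `N`-EQUIVARIANT (block-circulant) matrices
`(𝐌_e, 𝐍_e)`; `H_X e = 0 ⟺ 𝔅(A) 𝐌_e = 𝐍_e 𝔅(Bᵗ)` (`mem_pcCode_xMatrix_iff`); and `e ∈ rowsp 𝔅(H_Z) ⟸ 𝐌_e = G 𝔅(Bᵗ)`,
`𝐍_e = 𝔅(A) G` for an EQUIVARIANT `G` (`mem_rowSpace_zMatrix_of_chamber`). The chamber decomposition
(`chamber_decomposition`) produces `G = 𝟙 L₁ 𝐍_e' 𝟙` from a left inverse `L₁` of the column-restricted `𝔅(A)` and a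
right inverse of the row-restricted `𝔅(Bᵗ)`; `G` is equivariant as soon as these one-sided inverses are. The printed
proofs obtain the triviality of the restricted code from a dimension formula (Lemma 16 of [LinPryadko2024] via the
Panteleev–Kalachev decomposition and Smith normal forms; Theorem 3 / Consequence 4 of [KovalevPryadko2013Hyperbicycle]).
We REPLACE that step by the elementary `IsEquivariant.exists_left_inverse`: an `N`-equivariant matrix with trivial
kernel has an `N`-equivariant left inverse — from any left inverse `L₀` over the field, `L(b,h)(a,g) := L₀(b,0)(a,g−h)`
works (the self-injectivity of the group algebra `F[N]` on free modules; no semisimplicity, so the modular case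
`char F ∣ |N|` is covered uniformly). Everything else is index bookkeeping.

`TODO(general form)`: Statement 12 is printed for two-block GROUP-ALGEBRA codes `LP[a,b]` over a possibly non-abelian
`G` with `N = G_a ∩ G_b` central-like (abelian, normal in both support groups), via the identification
`LP[a,b] ≅ HP_{F[N]}[A₁,B₁]` (§IV.C / Statement 8); the present file proves the bound for the lifted product
`HP_{F[N]}[A₁,B₁]` itself (the form in which the proof is carried out in print), not the identification.
-/

namespace Literature.InformationTheory.QuantumCodes

open Matrix

namespace LiftedProduct

variable {F : Type*} {N : Type*} [AddCommGroup N] {α β γ : Type*}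

/-! ### `N`-equivariant (block-circulant) matrices -/

/-- A flat matrix on index types `α × N`, `β × N` is **`N`-equivariant** (block-`N`-circulant: every `N × N` block
is `circulant`, i.e. the matrix of an `F[N]`-linear map between free `F[N]`-modules) if it is invariant under
simultaneous translation of the two `N`-coordinates. (definition, auxiliary)
[cite: LinPryadko2024, §VIII.E (arXiv:2306.16400 chunk p0020 L6–10: matrices over `R = F[N]` «labeled by capital letters» vs «the corresponding matrices over `F` … formed by blocks `𝕃_N(a_ij) = ℝ_N(a_ij)`»)] -/
def IsEquivariant (M : Matrix (α × N) (β × N) F) : Prop :=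
  ∀ a g b h t, M (a, g + t) (b, h + t) = M (a, g) (b, h)

namespace IsEquivariant

/-- An equivariant matrix is determined by its columns `(b, 0)`. [cite: LinPryadko2024, §VIII.E proof of Statement 12 (arXiv:2306.16400 chunk p0020 L1–55)] -/
theorem apply_eq {M : Matrix (α × N) (β × N) F} (hM : IsEquivariant M) (a : α) (g : N) (b : β) (h : N) :
    M (a, g) (b, h) = M (a, g - h) (b, 0) := by
  have := hM a (g - h) b 0 h
  rwa [sub_add_cancel, zero_add] at this

/-- Two equivariant matrices agreeing on the columns `(b, 0)` are equal. [cite: LinPryadko2024, §VIII.E proof of Statement 12 (arXiv:2306.16400 chunk p0020 L1–55)] -/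
theorem ext {M M' : Matrix (α × N) (β × N) F} (hM : IsEquivariant M) (hM' : IsEquivariant M')
    (h : ∀ a g b, M (a, g) (b, 0) = M' (a, g) (b, 0)) : M = M' := by
  ext ⟨a, g⟩ ⟨b, k⟩
  rw [hM.apply_eq, hM'.apply_eq, h]

/-- The transpose of an equivariant matrix is equivariant. [folklore] -/
private theorem transpose {M : Matrix (α × N) (β × N) F} (hM : IsEquivariant M) : IsEquivariant Mᵀ :=
  fun b h a g t => by rw [transpose_apply, transpose_apply, hM]

/-- Block re-indexing preserves equivariance. [folklore] -/
private theorem submatrix {M : Matrix (α × N) (β × N) F} (hM : IsEquivariant M) {α' β' : Type*} (κ : α' → α)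
    (μ : β' → β) : IsEquivariant (M.submatrix (Prod.map κ id) (Prod.map μ id)) :=
  fun a g b h t => by simp only [submatrix_apply, Prod.map_apply, id_eq]; exact hM _ _ _ _ _

/-- Block re-indexing of rows preserves equivariance. [folklore] -/
private theorem submatrix_left {M : Matrix (α × N) (β × N) F} (hM : IsEquivariant M) {α' : Type*} (κ : α' → α) :
    IsEquivariant (M.submatrix (Prod.map κ id) id) :=
  fun a g b h t => by simp only [submatrix_apply, Prod.map_apply, id_eq]; exact hM _ _ _ _ _

/-- Block re-indexing of columns preserves equivariance. [folklore] -/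
private theorem submatrix_right {M : Matrix (α × N) (β × N) F} (hM : IsEquivariant M) {β' : Type*} (μ : β' → β) :
    IsEquivariant (M.submatrix id (Prod.map μ id)) :=
  fun a g b h t => by simp only [submatrix_apply, Prod.map_apply, id_eq]; exact hM _ _ _ _ _

/-- Products of equivariant matrices are equivariant (composition of `F[N]`-linear maps). [folklore] -/
private theorem mul [Fintype β] [Fintype N] [NonUnitalNonAssocSemiring F] {M : Matrix (α × N) (β × N) F}
    {M' : Matrix (β × N) (γ × N) F} (hM : IsEquivariant M) (hM' : IsEquivariant M') :
    IsEquivariant (M * M') := by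
  intro a g c k t
  rw [mul_apply, mul_apply]
  refine (Fintype.sum_equiv ((Equiv.refl β).prodCongr (Equiv.addRight t)) _ _ fun ⟨b, h⟩ => ?_).symm
  simp only [Equiv.prodCongr_apply, Equiv.coe_refl, Prod.map_apply, id_eq, Equiv.coe_addRight]
  rw [hM, hM']

end IsEquivariant

/-- The identity is equivariant. [folklore] -/
private theorem isEquivariant_one [DecidableEq α] [DecidableEq N] [Zero F] [One F] :
    IsEquivariant (1 : Matrix (α × N) (α × N) F) := by
  intro a g b h t
  simp only [one_apply, Prod.mk.injEq, add_left_inj]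

/-- A flat matrix of circulant blocks is equivariant.
[cite: LinPryadko2024, §VIII.E (arXiv:2306.16400 chunk p0020 L6–10: blocks `𝕃_N(a_ij) = ℝ_N(a_ij)`)] -/
theorem isEquivariant_comp_circulant (c : α → β → N → F) :
    IsEquivariant (Matrix.comp α β N N F fun a b => circulant (c a b)) := by
  intro a g b h t
  simp only [comp_apply, circulant_apply, add_sub_add_right_eq_sub]

/-! ### The equivariant left inverse (self-injectivity of `F[N]` on free modules) -/

section LeftInverse

variable [Field F] [Fintype α] [Fintype β] [Fintype N] [DecidableEq α] [DecidableEq β] [DecidableEq N]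

omit [Fintype N] [DecidableEq N] in
/-- A full-column-rank matrix over a field has a left inverse. [folklore] -/
private theorem exists_left_inverse_of_ker_eq_bot {V R : Type*} [Fintype V] [Fintype R] [DecidableEq R]
    [DecidableEq V] (A : Matrix V R F) (hA : LinearMap.ker A.mulVecLin = ⊥) :
    ∃ L : Matrix R V F, L * A = 1 := by
  obtain ⟨g, hg⟩ := A.mulVecLin.exists_leftInverse_of_injective hA
  refine ⟨LinearMap.toMatrix' g, ?_⟩
  have h := congrArg LinearMap.toMatrix' hg
  rwa [← Matrix.toLin'_apply', LinearMap.toMatrix'_comp, LinearMap.toMatrix'_toLin',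
    LinearMap.toMatrix'_id] at h

/-- **Equivariant left inverse.** An `N`-equivariant matrix with trivial kernel has an `N`-EQUIVARIANT left inverse:
from any left inverse `L₀`, `L (b,h) (a,g) := L₀ (b,0) (a, g − h)` works, because the row-`(b,0)` equations
`(L₀ M)_{(b,0),·} = δ` translate under the equivariance of `M`. (This is the self-injectivity of the group algebra
`F[N]` on free modules; no semisimplicity is needed.) This replaces Lemma 16 («trivial quasi-abelian LP codes») of
the printed proof. [cite: LinPryadko2024, Lemma 16 and its role in the proof of Statement 12 (arXiv:2306.16400 chunk p0019 L98–117, p0020 L40–48)] -/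
theorem IsEquivariant.exists_left_inverse {M : Matrix (α × N) (β × N) F} (hM : IsEquivariant M)
    (hinj : LinearMap.ker M.mulVecLin = ⊥) :
    ∃ L : Matrix (β × N) (α × N) F, IsEquivariant L ∧ L * M = 1 := by
  obtain ⟨L₀, hL₀⟩ := exists_left_inverse_of_ker_eq_bot M hinj
  refine ⟨Matrix.of fun x y => L₀ (x.1, 0) (y.1, y.2 - x.2), ?_, ?_⟩
  · intro b h a g t
    simp only [of_apply, add_sub_add_right_eq_sub]
  · ext ⟨b, h⟩ ⟨b', h'⟩
    rw [mul_apply]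
    have key : ∑ y : α × N, L₀ (b, 0) (y.1, y.2 - h) * M y (b', h') =
        ∑ y : α × N, L₀ (b, 0) y * M y (b', h' - h) := by
      refine (Fintype.sum_equiv ((Equiv.refl α).prodCongr (Equiv.addRight h)) _ _ fun ⟨a, g⟩ => ?_).symm
      simp only [Equiv.prodCongr_apply, Equiv.coe_refl, Prod.map_apply, id_eq, Equiv.coe_addRight,
        add_sub_cancel_right]
      have := hM a g b' (h' - h) h
      rw [sub_add_cancel] at this
      rw [this]
    simp only [of_apply]
    rw [key, ← mul_apply, hL₀, one_apply, one_apply]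
    by_cases hb : b = b'
    · subst hb
      by_cases hh : h = h'
      · subst hh; simp
      · have : (0 : N) ≠ h' - h := by rw [ne_comm, sub_ne_zero]; exact Ne.symm hh
        simp [this, hh]
    · simp [hb]

end LeftInverse

/-! ### The chamber decomposition with prescribed one-sided inverses -/

section Chamber

variable [Field F]
variable {V₁ E₁ E₂ W R₁ R₂ : Type*} [Fintype V₁] [Fintype E₁] [Fintype E₂] [Fintype W] [Fintype R₁]
  [Fintype R₂] [DecidableEq E₁] [DecidableEq E₂] [DecidableEq R₁] [DecidableEq R₂]

omit [Fintype V₁] [Fintype E₁] [Fintype E₂] [Fintype W] [Fintype R₂] [DecidableEq E₂] [DecidableEq R₁]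
  [DecidableEq R₂] in
/-- A matrix whose rows outside the range of an injection `ι` vanish is recovered from its restriction:
`M = 𝟙_ι · M|_ι`. [folklore] -/
private theorem inclusion_mul_restrict (ι : R₁ → E₁) (hι : Function.Injective ι) (M : Matrix E₁ W F)
    (hM : ∀ x, M x ≠ 0 → x ∈ Set.range ι) :
    (1 : Matrix E₁ E₁ F).submatrix id ι * M.submatrix ι id = M := by
  ext x w
  rw [Matrix.mul_apply]
  by_cases hx : x ∈ Set.range ι
  · obtain ⟨ρ, rfl⟩ := hx
    rw [Finset.sum_eq_single ρ]
    · change (1 : Matrix E₁ E₁ F) (ι ρ) (ι ρ) * M (ι ρ) w = M (ι ρ) w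
      rw [Matrix.one_apply_eq, one_mul]
    · intro ρ' _ hne
      have : ι ρ ≠ ι ρ' := fun h => hne (hι h).symm
      simp [this]
    · simp
  · have hzero : M x = 0 := not_not.mp fun h => hx (hM x h)
    rw [show M x w = 0 from congrFun hzero w]
    refine Finset.sum_eq_zero fun ρ _ => ?_
    have : x ≠ ι ρ := fun h => hx ⟨ρ, h.symm⟩
    simp [this]

omit [Fintype V₁] [Fintype E₁] [Fintype E₂] [Fintype W] [Fintype R₁] [DecidableEq E₁] [DecidableEq R₁]
  [DecidableEq R₂] in
/-- Dually for columns: `N = N|^ι · 𝟙^ι`. [folklore] -/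
private theorem restrict_mul_inclusion (ι : R₂ → E₂) (hι : Function.Injective ι) (Nm : Matrix V₁ E₂ F)
    (hN : ∀ y, Nmᵀ y ≠ 0 → y ∈ Set.range ι) :
    Nm.submatrix id ι * (1 : Matrix E₂ E₂ F).submatrix ι id = Nm := by
  ext v y
  rw [Matrix.mul_apply]
  by_cases hy : y ∈ Set.range ι
  · obtain ⟨ρ, rfl⟩ := hy
    rw [Finset.sum_eq_single ρ]
    · change Nm v (ι ρ) * (1 : Matrix E₂ E₂ F) (ι ρ) (ι ρ) = Nm v (ι ρ)
      rw [Matrix.one_apply_eq, mul_one]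
    · intro ρ' _ hne
      have : ι ρ' ≠ ι ρ := fun h => hne (hι h)
      simp [this]
    · simp
  · have hzero : Nmᵀ y = 0 := not_not.mp fun h => hy (hN y h)
    rw [show Nm v y = 0 from congrFun hzero v]
    refine Finset.sum_eq_zero fun ρ _ => ?_
    have : ι ρ ≠ y := fun h => hy ⟨ρ, h⟩
    simp [this]

omit [Fintype V₁] [Fintype W] [Fintype R₁] [Fintype R₂] [DecidableEq R₁] [DecidableEq R₂] in
/-- `H · 𝟙_ι = H|_ι` (column restriction). [folklore] -/
private theorem mul_inclusion_eq (ι : R₁ → E₁) (H₁ : Matrix V₁ E₁ F) :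
    H₁ * (1 : Matrix E₁ E₁ F).submatrix id ι = H₁.submatrix id ι := by
  simpa using Matrix.mul_submatrix_one (Equiv.refl E₁) ι H₁

omit [Fintype V₁] [Fintype E₁] [Fintype W] [Fintype R₁] [Fintype R₂] [DecidableEq E₁] [DecidableEq R₁]
  [DecidableEq R₂] in
/-- `𝟙^ι · K = K|^ι` (row restriction). [folklore] -/
private theorem inclusion_mul_eq (ι : R₂ → E₂) (K : Matrix E₂ W F) :
    (1 : Matrix E₂ E₂ F).submatrix ι id * K = K.submatrix ι id := by
  simpa using Matrix.one_submatrix_mul ι (Equiv.refl E₂) K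

/-- **Chamber decomposition with prescribed inverses** (the algebra of the Tillich–Zémor / Kovalev–Pryadko
restriction argument, with the one-sided inverses of the restricted matrices as DATA so that structure — here
`N`-equivariance — can be read off the explicit formula). If `H₁ M = N K`, the nonzero rows of `M` lie in the range
of `ι₁`, the nonzero columns of `N` in the range of `ι₂`, `L₁` is a left inverse of the column-restriction
`H₁|_{ι₁}` and `P₂` a right inverse of the row-restriction `K|^{ι₂}`, then with
`G := 𝟙_{ι₁} L₁ N|^{ι₂} 𝟙^{ι₂}` one has `M = G K` and `N = H₁ G`.
[cite: TillichZemor2014, proof of Thm 9 (arXiv:0903.0566v1 chunk p0008 L16–45)]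
[cite: LinPryadko2024, §VIII.E proof of Statement 12 (arXiv:2306.16400 chunk p0020 L1–55)] -/
theorem chamber_decomposition (H₁ : Matrix V₁ E₁ F) (K : Matrix E₂ W F) (M : Matrix E₁ W F)
    (Nm : Matrix V₁ E₂ F) (hMN : H₁ * M = Nm * K)
    (ι₁ : R₁ → E₁) (hι₁ : Function.Injective ι₁) (hM : ∀ x, M x ≠ 0 → x ∈ Set.range ι₁)
    (ι₂ : R₂ → E₂) (hι₂ : Function.Injective ι₂) (hN : ∀ y, Nmᵀ y ≠ 0 → y ∈ Set.range ι₂)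
    (L₁ : Matrix R₁ V₁ F) (hL₁ : L₁ * H₁.submatrix id ι₁ = 1)
    (P₂ : Matrix W R₂ F) (hP₂ : K.submatrix ι₂ id * P₂ = 1) :
    M = ((1 : Matrix E₁ E₁ F).submatrix id ι₁ * L₁ * Nm.submatrix id ι₂ *
        (1 : Matrix E₂ E₂ F).submatrix ι₂ id) * K ∧
    Nm = H₁ * ((1 : Matrix E₁ E₁ F).submatrix id ι₁ * L₁ * Nm.submatrix id ι₂ *
        (1 : Matrix E₂ E₂ F).submatrix ι₂ id) := by
  set I₁ := (1 : Matrix E₁ E₁ F).submatrix id ι₁ with hI₁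
  set I₂ := (1 : Matrix E₂ E₂ F).submatrix ι₂ id with hI₂
  set H₁' := H₁.submatrix id ι₁
  set K' := K.submatrix ι₂ id
  set M' := M.submatrix ι₁ id
  set N' := Nm.submatrix id ι₂
  have hHI : H₁ * I₁ = H₁' := mul_inclusion_eq ι₁ H₁
  have hIK : I₂ * K = K' := inclusion_mul_eq ι₂ K
  have hMd : I₁ * M' = M := inclusion_mul_restrict ι₁ hι₁ M hM
  have hNd : N' * I₂ = Nm := restrict_mul_inclusion ι₂ hι₂ Nm hN
  -- the restricted cycle equation `H₁' M' = N' K'`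
  have hMN' : H₁' * M' = N' * K' := by
    rw [← hHI, Matrix.mul_assoc, hMd, hMN, ← hNd, Matrix.mul_assoc, hIK]
  -- `N' = H₁' M' P₂`
  have hN' : N' = H₁' * M' * P₂ := by
    rw [hMN', Matrix.mul_assoc, hP₂, Matrix.mul_one]
  set G' := L₁ * N' with hG'
  have hG'K : G' * K' = M' := by
    rw [hG', Matrix.mul_assoc, ← hMN', ← Matrix.mul_assoc, hL₁, Matrix.one_mul]
  have hHG' : H₁' * G' = N' := by
    rw [hG', hN', ← Matrix.mul_assoc, ← Matrix.mul_assoc, ← Matrix.mul_assoc (H₁' * L₁), Matrix.mul_assoc H₁',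
      hL₁, Matrix.mul_one]
  constructor
  · calc M = I₁ * M' := hMd.symm
      _ = I₁ * (G' * K') := by rw [hG'K]
      _ = I₁ * L₁ * N' * I₂ * K := by
        rw [← hIK, hG']; simp only [Matrix.mul_assoc]
  · calc Nm = N' * I₂ := hNd.symm
      _ = H₁' * G' * I₂ := by rw [hHG']
      _ = H₁ * (I₁ * L₁ * N' * I₂) := by
        rw [← hHI, hG']; simp only [Matrix.mul_assoc]

end Chamber

section QuasiAbelian

variable {F : Type*} [Field F] {N : Type*} [AddCommGroup N] [Fintype N] [DecidableEq N]
variable {mA nA mB nB : Type*} [Fintype mA] [Fintype nA] [Fintype mB] [Fintype nB]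
  [DecidableEq mA] [DecidableEq nA] [DecidableEq mB] [DecidableEq nB]

/-! ### Quasi-abelian lifted products: blocks `circulant (α i j)` over a finite abelian group `N` -/

/-- The flat matrix `𝔅(A)` of the block matrix `A = (circulant (α i j))`: entries `((i,g),(j,h)) ↦ α i j (g − h)`.
(abbreviation) [cite: LinPryadko2024, §VIII.E (arXiv:2306.16400 chunk p0020 L6–10: the bold matrices over `F` formed by the blocks `𝕃_N(a_ij)`)] -/
abbrev flat {I J : Type*} (α : I → J → N → F) : Matrix (I × N) (J × N) F :=
  Matrix.comp I J N N F fun i j => circulant (α i j)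

omit [Field F] [Fintype N] [DecidableEq N] in
/-- Entries of `𝔅(A)`. [cite: LinPryadko2024, §VIII.E (arXiv:2306.16400 chunk p0020 L6–10)] -/
theorem flat_apply {I J : Type*} (α : I → J → N → F) (i : I) (g : N) (j : J) (h : N) :
    flat α (i, g) (j, h) = α i j (g - h) := rfl

omit [Field F] [Fintype N] [DecidableEq N] in
/-- `𝔅(A)` is equivariant. [cite: LinPryadko2024, §VIII.E (arXiv:2306.16400 chunk p0020 L6–10)] -/
theorem isEquivariant_flat {I J : Type*} (α : I → J → N → F) : IsEquivariant (flat α) :=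
  isEquivariant_comp_circulant α

/-- The `R`-matrix of the left block of a qubit vector, in flat form: `𝐌_e (j,g) (s,h) = e (inl (j,s), g − h)`.
(definition, auxiliary) [cite: LinPryadko2024, §VIII.E (arXiv:2306.16400 chunk p0020 L19–24: a vector `e ∈ F^{2ℓ}` of the code «equivalent to the R-linear code HP[A₁,B₁]»)] -/
def leftMat (e : (((nA × mB) ⊕ (mA × nB)) × N) → F) : Matrix (nA × N) (mB × N) F :=
  Matrix.of fun x y => e (Sum.inl (x.1, y.1), x.2 - y.2)

/-- The `R`-matrix of the right block of a qubit vector, in flat form: `𝐍_e (i,g) (u,h) = e (inr (i,u), g − h)`.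
(definition, auxiliary) [cite: LinPryadko2024, §VIII.E (arXiv:2306.16400 chunk p0020 L19–24)] -/
def rightMat (e : (((nA × mB) ⊕ (mA × nB)) × N) → F) : Matrix (mA × N) (nB × N) F :=
  Matrix.of fun x y => e (Sum.inr (x.1, y.1), x.2 - y.2)

omit [Field F] [Fintype N] [DecidableEq N] [Fintype mA] [Fintype nA] [Fintype mB] [Fintype nB] [DecidableEq mA]
  [DecidableEq nA] [DecidableEq mB] [DecidableEq nB] in
/-- Entries of `𝐌_e`. [cite: LinPryadko2024, §VIII.E (arXiv:2306.16400 chunk p0020 L19–24)] -/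
theorem leftMat_apply (e : (((nA × mB) ⊕ (mA × nB)) × N) → F) (x : nA × N) (y : mB × N) :
    leftMat e x y = e (Sum.inl (x.1, y.1), x.2 - y.2) := rfl

omit [Field F] [Fintype N] [DecidableEq N] [Fintype mA] [Fintype nA] [Fintype mB] [Fintype nB] [DecidableEq mA]
  [DecidableEq nA] [DecidableEq mB] [DecidableEq nB] in
/-- Entries of `𝐍_e`. [cite: LinPryadko2024, §VIII.E (arXiv:2306.16400 chunk p0020 L19–24)] -/
theorem rightMat_apply (e : (((nA × mB) ⊕ (mA × nB)) × N) → F) (x : mA × N) (y : nB × N) :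
    rightMat e x y = e (Sum.inr (x.1, y.1), x.2 - y.2) := rfl

omit [Field F] [Fintype N] [DecidableEq N] [Fintype mA] [Fintype nA] [Fintype mB] [Fintype nB] [DecidableEq mA]
  [DecidableEq nA] [DecidableEq mB] [DecidableEq nB] in
/-- `𝐌_e` is equivariant. [cite: LinPryadko2024, §VIII.E (arXiv:2306.16400 chunk p0020 L19–24)] -/
theorem isEquivariant_leftMat (e : (((nA × mB) ⊕ (mA × nB)) × N) → F) : IsEquivariant (leftMat e) :=
  fun _ _ _ _ _ => by simp only [leftMat_apply, add_sub_add_right_eq_sub]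

omit [Field F] [Fintype N] [DecidableEq N] [Fintype mA] [Fintype nA] [Fintype mB] [Fintype nB] [DecidableEq mA]
  [DecidableEq nA] [DecidableEq mB] [DecidableEq nB] in
/-- `𝐍_e` is equivariant. [cite: LinPryadko2024, §VIII.E (arXiv:2306.16400 chunk p0020 L19–24)] -/
theorem isEquivariant_rightMat (e : (((nA × mB) ⊕ (mA × nB)) × N) → F) : IsEquivariant (rightMat e) :=
  fun _ _ _ _ _ => by simp only [rightMat_apply, add_sub_add_right_eq_sub]

omit [DecidableEq nA] [DecidableEq nB] in
/-- The `X`-syndrome of `e` at `((i,s),a)`, as two block sums (`H_X = [A ⊗ I, −I ⊗ B]`).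
[cite: PanteleevKalachev2022LP, §III.D (arXiv:2012.04068 chunk p0011 L5–12)] -/
theorem xMatrix_mulVec_apply (α : mA → nA → N → F) (β : mB → nB → N → F)
    (e : (((nA × mB) ⊕ (mA × nB)) × N) → F) (i : mA) (s : mB) (a : N) :
    (xMatrix (fun i j => circulant (α i j)) (fun s u => circulant (β s u)) *ᵥ e) ((i, s), a) =
      (∑ j, ∑ b, α i j (a - b) * e (Sum.inl (j, s), b)) - ∑ u, ∑ b, β s u (a - b) * e (Sum.inr (i, u), b) := by
  rw [xMatrix_eq_of_xEntry]
  simp only [mulVec, dotProduct, of_apply]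
  rw [Fintype.sum_prod_type, Fintype.sum_sum_type, Fintype.sum_prod_type, Fintype.sum_prod_type, sub_eq_add_neg]
  congr 1
  · refine Finset.sum_congr rfl fun j _ => ?_
    rw [Finset.sum_eq_single s]
    · simp [xEntry, circulant_apply]
    · intro s' _ hs'
      simp [xEntry, Ne.symm hs']
    · simp
  · rw [Finset.sum_eq_single i]
    · simp [xEntry, circulant_apply, Finset.sum_neg_distrib]
    · intro i' _ hi'
      simp [xEntry, Ne.symm hi']
    · simp

omit [DecidableEq nA] [DecidableEq nB] in
/-- **Kernel of `𝔅(H_X)` in `R`-matrix form:** `H_X e = 0 ⟺ 𝔅(A) 𝐌_e = 𝐍_e 𝔅(Bᵗ)`, `Bᵗ` the `R`-transpose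
`(u,s) ↦ β s u` (blocks NOT transposed) — the cycle condition of the `R`-linear code `HP_R[A,B]`.
[cite: LinPryadko2024, §VIII.E (arXiv:2306.16400 chunk p0020 L19–30: «𝐇_X e = 0» for the code equivalent to HP[A₁,B₁])] -/
theorem mem_pcCode_xMatrix_iff (α : mA → nA → N → F) (β : mB → nB → N → F)
    (e : (((nA × mB) ⊕ (mA × nB)) × N) → F) :
    e ∈ pcCode (xMatrix (fun i j => circulant (α i j)) (fun s u => circulant (β s u))) ↔
      flat α * leftMat e = rightMat e * flat (fun u s => β s u) := by
  have hL : ∀ i s a, (flat α * leftMat e) (i, a) (s, 0) = ∑ j, ∑ b, α i j (a - b) * e (Sum.inl (j, s), b) := by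
    intro i s a
    rw [mul_apply, Fintype.sum_prod_type]
    simp only [flat_apply, leftMat_apply, sub_zero]
  have hR : ∀ i s a, (rightMat e * flat (fun u s => β s u)) (i, a) (s, 0) =
      ∑ u, ∑ b, β s u (a - b) * e (Sum.inr (i, u), b) := by
    intro i s a
    rw [mul_apply, Fintype.sum_prod_type]
    refine Finset.sum_congr rfl fun u _ => ?_
    simp only [flat_apply, rightMat_apply, sub_zero]
    refine Fintype.sum_equiv (Equiv.subLeft a) _ _ fun b => ?_
    simp only [Equiv.subLeft_apply, sub_sub_cancel, mul_comm]
  rw [mem_pcCode_iff]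
  constructor
  · intro h
    refine IsEquivariant.ext ((isEquivariant_flat α).mul (isEquivariant_leftMat e))
      ((isEquivariant_rightMat e).mul (isEquivariant_flat _)) fun i a s => ?_
    have := congrFun h ((i, s), a)
    rw [xMatrix_mulVec_apply, Pi.zero_apply, sub_eq_zero] at this
    rw [hL, hR, this]
  · intro h
    funext x
    obtain ⟨⟨i, s⟩, a⟩ := x
    rw [xMatrix_mulVec_apply, ← hL, ← hR, h, Pi.zero_apply, sub_self]

omit [Fintype mA] [Fintype mB] [DecidableEq mA] [DecidableEq mB] in
/-- Row vector times `𝔅(H_Z)`, left block (`H_Z = [I ⊗ B*, A* ⊗ I]`). [cite: PanteleevKalachev2022LP, §III.D (arXiv:2012.04068 chunk p0011 L5–12)] -/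
theorem vecMul_zMatrix_inl (α : mA → nA → N → F) (β : mB → nB → N → F) (w : ((nA × nB) × N) → F)
    (j' : nA) (s : mB) (b : N) :
    (w ᵥ* zMatrix (fun i j => circulant (α i j)) (fun s u => circulant (β s u))) (Sum.inl (j', s), b) =
      ∑ u, ∑ a, w ((j', u), a) * β s u (b - a) := by
  rw [zMatrix_eq_of_zEntry]
  simp only [vecMul, dotProduct, of_apply]
  rw [Fintype.sum_prod_type, Fintype.sum_prod_type, Finset.sum_eq_single j']
  · simp [zEntry, circulant_apply]
  · intro j _ hj
    simp [zEntry, hj]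
  · simp

omit [Fintype mA] [Fintype mB] [DecidableEq mA] [DecidableEq mB] in
/-- Row vector times `𝔅(H_Z)`, right block. [cite: PanteleevKalachev2022LP, §III.D (arXiv:2012.04068 chunk p0011 L5–12)] -/
theorem vecMul_zMatrix_inr (α : mA → nA → N → F) (β : mB → nB → N → F) (w : ((nA × nB) × N) → F)
    (i : mA) (u' : nB) (b : N) :
    (w ᵥ* zMatrix (fun i j => circulant (α i j)) (fun s u => circulant (β s u))) (Sum.inr (i, u'), b) =
      ∑ j, ∑ a, w ((j, u'), a) * α i j (b - a) := by
  rw [zMatrix_eq_of_zEntry]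
  simp only [vecMul, dotProduct, of_apply]
  rw [Fintype.sum_prod_type, Fintype.sum_prod_type]
  refine Finset.sum_congr rfl fun j _ => ?_
  rw [Finset.sum_eq_single u']
  · simp [zEntry, circulant_apply]
  · intro u _ hu
    simp [zEntry, hu]
  · simp

omit [Fintype mA] [Fintype mB] [DecidableEq mA] [DecidableEq mB] in
/-- **Stabilizers from an equivariant chamber decomposition:** if `𝐌_e = G 𝔅(Bᵗ)` and `𝐍_e = 𝔅(A) G` with `G`
`N`-equivariant, then `e` lies in the row space of `𝔅(H_Z)` (it is `H_Zᵀ w` for `w((j,u),a) := G (j,a) (u,0)`).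
[cite: LinPryadko2024, §VIII.E (arXiv:2306.16400 chunk p0020 L44–50: «a linear combination of the rows of 𝐇_Z' … thus the full vector e is a linear combination of the rows of the original matrix 𝐇_Z»)] -/
theorem mem_rowSpace_zMatrix_of_chamber (α : mA → nA → N → F) (β : mB → nB → N → F)
    {e : (((nA × mB) ⊕ (mA × nB)) × N) → F} {G : Matrix (nA × N) (nB × N) F} (hG : IsEquivariant G)
    (hM : leftMat e = G * flat (fun u s => β s u)) (hN : rightMat e = flat α * G) :
    e ∈ rowSpace (zMatrix (fun i j => circulant (α i j)) (fun s u => circulant (β s u))) := by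
  rw [mem_rowSpace_iff]
  refine ⟨fun x => G (x.1.1, x.2) (x.1.2, 0), ?_⟩
  funext x
  obtain ⟨c, b⟩ := x
  rcases c with ⟨j', s⟩ | ⟨i, u'⟩
  · rw [vecMul_zMatrix_inl]
    have h := congrFun (congrFun hM (j', b)) (s, 0)
    rw [leftMat_apply, sub_zero, mul_apply, Fintype.sum_prod_type] at h
    simp only [flat_apply, sub_zero] at h
    rw [h]
    refine Finset.sum_congr rfl fun u _ => ?_
    refine (Fintype.sum_equiv (Equiv.subLeft b) _ _ fun a => ?_)
    simp only [Equiv.subLeft_apply]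
    rw [hG.apply_eq j' b u (b - a), sub_sub_cancel]
  · rw [vecMul_zMatrix_inr]
    have h := congrFun (congrFun hN (i, b)) (u', 0)
    rw [rightMat_apply, sub_zero, mul_apply, Fintype.sum_prod_type] at h
    simp only [flat_apply] at h
    rw [h]
    refine Finset.sum_congr rfl fun j _ => Finset.sum_congr rfl fun a _ => ?_
    rw [mul_comm]

/-! ### Supports, restriction, injectivity -/

omit [Fintype N] [DecidableEq N] [Fintype mA] [Fintype nA] [Fintype mB] [Fintype nB] [DecidableEq mA]
  [DecidableEq nA] [DecidableEq mB] [DecidableEq nB] in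
/-- The nonzero rows of `𝐌_e` are indexed by the columns of `A` that occur in `e`.
[cite: LinPryadko2024, §VIII.E (arXiv:2306.16400 chunk p0020 L25–30: the sets `ℐ_A ⊂ [ℓ_a]` «indexing only the columns of the matrices A₁ … incident on non-zero elements of e»)] -/
private theorem leftMat_rows (e : (((nA × mB) ⊕ (mA × nB)) × N) → F) (x : nA × N) (hx : leftMat e x ≠ 0) :
    x ∈ Set.range (Prod.map (Subtype.val : {j : nA // ∃ s g, e (Sum.inl (j, s), g) ≠ 0} → nA) id) := by
  obtain ⟨y, hy⟩ := Function.ne_iff.1 hx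
  exact ⟨(⟨x.1, y.1, x.2 - y.2, hy⟩, x.2), rfl⟩

omit [Fintype N] [DecidableEq N] [Fintype mA] [Fintype nA] [Fintype mB] [Fintype nB] [DecidableEq mA]
  [DecidableEq nA] [DecidableEq mB] [DecidableEq nB] in
/-- The nonzero columns of `𝐍_e` are indexed by the columns of `B` that occur in `e`.
[cite: LinPryadko2024, §VIII.E (arXiv:2306.16400 chunk p0020 L25–30: the set `ℐ_B ⊂ [ℓ_b]`)] -/
private theorem rightMat_cols (e : (((nA × mB) ⊕ (mA × nB)) × N) → F) (y : nB × N) (hy : (rightMat e)ᵀ y ≠ 0) :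
    y ∈ Set.range (Prod.map (Subtype.val : {u : nB // ∃ i g, e (Sum.inr (i, u), g) ≠ 0} → nB) id) := by
  obtain ⟨x, hx⟩ := Function.ne_iff.1 hy
  exact ⟨(⟨y.1, x.1, x.2 - y.2, hx⟩, y.2), rfl⟩

variable [DecidableEq F]

omit [AddCommGroup N] [DecidableEq N] [DecidableEq mA] [DecidableEq nA] [DecidableEq mB] [DecidableEq nB] in
/-- At most `wt(e)` columns of `A` occur in `e` (`|ℐ'_A| = c|ℐ_A| ≤ c·wgt(e)`).
[cite: LinPryadko2024, §VIII.E (arXiv:2306.16400 chunk p0020 L33–36)] [cite: KovalevPryadko2013Hyperbicycle, Thm 5 and proof (arXiv:1212.6703 chunk p0011 L83–104)] -/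
private theorem card_leftIdx_le (e : (((nA × mB) ⊕ (mA × nB)) × N) → F)
    [Fintype {j : nA // ∃ s g, e (Sum.inl (j, s), g) ≠ 0}] :
    Fintype.card {j : nA // ∃ s g, e (Sum.inl (j, s), g) ≠ 0} ≤ hammingNorm e := by
  classical
  have hch : ∀ j : {j : nA // ∃ s g, e (Sum.inl (j, s), g) ≠ 0}, ∃ p : mB × N, e (Sum.inl (j.1, p.1), p.2) ≠ 0 :=
    fun ⟨j, s, g, h⟩ => ⟨(s, g), h⟩
  choose f hf using hch
  unfold hammingNorm
  rw [← Finset.card_univ]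
  refine Finset.card_le_card_of_injOn (fun j => (Sum.inl (j.1, (f j).1), (f j).2)) (fun j _ => by simpa using hf j) ?_
  rintro j - j' - h
  simp only [Prod.mk.injEq, Sum.inl.injEq] at h
  exact Subtype.ext h.1.1

omit [AddCommGroup N] [DecidableEq N] [DecidableEq mA] [DecidableEq nA] [DecidableEq mB] [DecidableEq nB] in
/-- At most `wt(e)` columns of `B` occur in `e` (`|ℐ'_B| = c|ℐ_B| ≤ c·wgt(e)`).
[cite: LinPryadko2024, §VIII.E (arXiv:2306.16400 chunk p0020 L33–36)] [cite: KovalevPryadko2013Hyperbicycle, Thm 5 and proof (arXiv:1212.6703 chunk p0011 L83–104)] -/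
private theorem card_rightIdx_le (e : (((nA × mB) ⊕ (mA × nB)) × N) → F)
    [Fintype {u : nB // ∃ i g, e (Sum.inr (i, u), g) ≠ 0}] :
    Fintype.card {u : nB // ∃ i g, e (Sum.inr (i, u), g) ≠ 0} ≤ hammingNorm e := by
  classical
  have hch : ∀ u : {u : nB // ∃ i g, e (Sum.inr (i, u), g) ≠ 0}, ∃ p : mA × N, e (Sum.inr (p.1, u.1), p.2) ≠ 0 :=
    fun ⟨u, i, g, h⟩ => ⟨(i, g), h⟩
  choose f hf using hch
  unfold hammingNorm
  rw [← Finset.card_univ]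
  refine Finset.card_le_card_of_injOn (fun u => (Sum.inr ((f u).1, u.1), (f u).2)) (fun u _ => by simpa using hf u) ?_
  rintro u - u' - h
  simp only [Prod.mk.injEq, Sum.inr.injEq] at h
  exact Subtype.ext h.1.2

omit [Fintype N] [DecidableEq N] [Fintype mA] [Fintype nA] [Fintype mB] [Fintype nB] [DecidableEq mA]
  [DecidableEq nA] [DecidableEq mB] [DecidableEq nB] in
/-- **Light restriction sets are injective**: if `|R| < d(ker H)` then the columns of `H` indexed by an injection
`ι : R → E` are linearly independent (a dependency would be a nonzero kernel vector of weight `≤ |R|`).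
[cite: TillichZemor2014, proof of Thm 9 (arXiv v1 chunk p0008 L30-37); KovalevPryadko2013Hyperbicycle, proof of Thm 5 (arXiv:1212.6703 chunk p0011 L92-97)] -/
theorem ker_submatrix_eq_bot_of_card_lt_minDist {V E R : Type*} [Fintype V] [Fintype E] [Fintype R]
    [DecidableEq E] [DecidableEq R] (H : Matrix V E F) (ι : R → E) (hι : Function.Injective ι)
    (hR : (Fintype.card R : ℕ∞) < Coding.minDist (pcCode H)) :
    LinearMap.ker (H.submatrix id ι).mulVecLin = ⊥ := by
  rw [LinearMap.ker_eq_bot']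
  intro x hx
  rw [Matrix.mulVecLin_apply] at hx
  set I : Matrix E R F := (1 : Matrix E E F).submatrix id ι with hI
  have hHI : H * I = H.submatrix id ι := by
    simpa [hI] using Matrix.mul_submatrix_one (Equiv.refl E) ι H
  have hIx : ∀ ρ, (I *ᵥ x) (ι ρ) = x ρ := fun ρ => by
    rw [Matrix.mulVec, dotProduct, Finset.sum_eq_single ρ]
    · change (1 : Matrix E E F) (ι ρ) (ι ρ) * x ρ = x ρ
      rw [Matrix.one_apply_eq, one_mul]
    · intro ρ' _ hne
      have : ι ρ ≠ ι ρ' := fun h => hne (hι h).symm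
      simp [hI, this]
    · simp
  have hIx0 : ∀ a, a ∉ Set.range ι → (I *ᵥ x) a = 0 := fun a ha => by
    rw [Matrix.mulVec, dotProduct]
    refine Finset.sum_eq_zero fun ρ _ => ?_
    have : a ≠ ι ρ := fun h => ha ⟨ρ, h.symm⟩
    simp [hI, this]
  have hmem : I *ᵥ x ∈ pcCode H := by
    rw [mem_pcCode_iff, Matrix.mulVec_mulVec, hHI, hx]
  have hwt : hammingNorm (I *ᵥ x) ≤ Fintype.card R := by
    unfold hammingNorm
    calc (Finset.univ.filter fun a => (I *ᵥ x) a ≠ 0).card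
        ≤ (Finset.univ.image ι).card := by
          refine Finset.card_le_card fun a ha => ?_
          rw [Finset.mem_filter] at ha
          by_contra hni
          exact ha.2 (hIx0 a fun ⟨ρ, hρ⟩ => hni (Finset.mem_image.2 ⟨ρ, Finset.mem_univ _, hρ⟩))
      _ ≤ Fintype.card R := Finset.card_image_le.trans (by simp)
  have hzero : I *ᵥ x = 0 := by
    by_contra hne
    have h := Coding.minDist_le_hammingNorm hmem hne
    exact (lt_irrefl _) ((hR.trans_le h).trans_le (by exact_mod_cast hwt))
  ext ρ
  rw [← hIx ρ, hzero, Pi.zero_apply, Pi.zero_apply]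

omit [Fintype N] [DecidableEq N] [Fintype mA] [Fintype nA] [Fintype mB] [Fintype nB] [DecidableEq mA]
  [DecidableEq nA] [DecidableEq mB] [DecidableEq nB] [DecidableEq F] in
/-- Injectivity is invariant under re-indexing by bijections. [folklore] -/
private theorem ker_submatrix_equiv_eq_bot {m n m' n' : Type*} [Fintype m] [Fintype n] [Fintype m'] [Fintype n']
    (M : Matrix m n F) (e₁ : m' ≃ m) (e₂ : n' ≃ n) (h : LinearMap.ker M.mulVecLin = ⊥) :
    LinearMap.ker (M.submatrix e₁ e₂).mulVecLin = ⊥ := by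
  rw [LinearMap.ker_eq_bot'] at h ⊢
  intro v hv
  rw [Matrix.mulVecLin_apply, Matrix.submatrix_mulVec_equiv] at hv
  have h1 : M *ᵥ (v ∘ e₂.symm) = 0 := by
    funext x
    have := congrFun hv (e₁.symm x)
    simpa using this
  have h2 := h _ (by rw [Matrix.mulVecLin_apply]; exact h1)
  funext y
  have := congrFun h2 (e₂ y)
  simpa using this

/-! ### The distance bound (cycle half) -/

/-- **Lin–Pryadko Statement 12 / Kovalev–Pryadko Theorem 5, `Z`-sector, for quasi-abelian lifted-product codes.**
For the lifted product `LP(A,B)` of block matrices `A = (circulant (α i j))`, `B = (circulant (β s u))` over the group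
algebra `F[N]` of a finite abelian group `N` (`|N| = c`): every vector of `ker 𝔅(H_X) ∖ rowsp 𝔅(H_Z)` has weight `w`
with `min(d(ker 𝔅(A)), d(ker 𝔅(B))) ≤ c · w`, i.e. `d_Z ≥ ⌈min(d_A^⊥, d_B^⊥)/c⌉`.
[cite: LinPryadko2024, Statement 12 and its proof (arXiv:2306.16400 chunk p0011 L101–110, p0020 L1–55)] [cite: KovalevPryadko2013Hyperbicycle, Thm 5 and proof (arXiv:1212.6703 chunk p0011 L83–104)] -/
theorem min_minDist_le_card_mul_hammingNorm_of_cycle (α : mA → nA → N → F) (β : mB → nB → N → F)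
    {e : (((nA × mB) ⊕ (mA × nB)) × N) → F}
    (he : e ∈ pcCode (xMatrix (fun i j => circulant (α i j)) (fun s u => circulant (β s u))))
    (hne : e ∉ rowSpace (zMatrix (fun i j => circulant (α i j)) (fun s u => circulant (β s u)))) :
    min (Coding.minDist (pcCode (flat α))) (Coding.minDist (pcCode (flat β))) ≤
      ((Fintype.card N * hammingNorm e : ℕ) : ℕ∞) := by
  classical
  by_contra hlt
  rw [not_le, lt_min_iff] at hlt
  apply hne
  -- the occurring columns
  set ι₁ : {j : nA // ∃ s g, e (Sum.inl (j, s), g) ≠ 0} × N → nA × N := Prod.map Subtype.val id with hι₁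
  set ι₂ : {u : nB // ∃ i g, e (Sum.inr (i, u), g) ≠ 0} × N → nB × N := Prod.map Subtype.val id with hι₂
  have hι₁i : Function.Injective ι₁ := Subtype.val_injective.prodMap Function.injective_id
  have hι₂i : Function.Injective ι₂ := Subtype.val_injective.prodMap Function.injective_id
  have hc₁ : (Fintype.card ({j : nA // ∃ s g, e (Sum.inl (j, s), g) ≠ 0} × N) : ℕ∞) <
      Coding.minDist (pcCode (flat α)) := by
    refine lt_of_le_of_lt ?_ hlt.1
    rw [Fintype.card_prod, Nat.cast_le, mul_comm]
    exact Nat.mul_le_mul_left _ (card_leftIdx_le e)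
  have hc₂ : (Fintype.card ({u : nB // ∃ i g, e (Sum.inr (i, u), g) ≠ 0} × N) : ℕ∞) <
      Coding.minDist (pcCode (flat β)) := by
    refine lt_of_le_of_lt ?_ hlt.2
    rw [Fintype.card_prod, Nat.cast_le, mul_comm]
    exact Nat.mul_le_mul_left _ (card_rightIdx_le e)
  -- equivariant left inverse of the column-restricted `𝔅(A)`
  have hk₁ := ker_submatrix_eq_bot_of_card_lt_minDist (flat α) ι₁ hι₁i hc₁
  obtain ⟨L₁, hL₁e, hL₁⟩ := ((isEquivariant_flat α).submatrix_right (Subtype.val)).exists_left_inverse hk₁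
  -- equivariant right inverse of the row-restricted `𝔅(Bᵗ)`, via the transpose
  set K : Matrix (nB × N) (mB × N) F := flat (fun u s => β s u) with hK
  have hk₂ := ker_submatrix_eq_bot_of_card_lt_minDist (flat β) ι₂ hι₂i hc₂
  have hKT : (K.submatrix ι₂ id)ᵀ = ((flat β).submatrix id ι₂).submatrix
      ((Equiv.refl mB).prodCongr (Equiv.neg N))
      ((Equiv.refl {u : nB // ∃ i g, e (Sum.inr (i, u), g) ≠ 0}).prodCongr (Equiv.neg N)) := by
    ext ⟨s, h⟩ ⟨u, g⟩
    simp only [hK, hι₂, transpose_apply, submatrix_apply, Prod.map_apply, id_eq, Equiv.prodCongr_apply,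
      Equiv.coe_refl, Equiv.neg_apply, flat_apply, neg_sub_neg]
  have hk₂' : LinearMap.ker ((K.submatrix ι₂ id)ᵀ).mulVecLin = ⊥ := by
    rw [hKT]; exact ker_submatrix_equiv_eq_bot _ _ _ hk₂
  have hKTe : IsEquivariant (K.submatrix ι₂ id)ᵀ := by
    rw [transpose_submatrix]; exact (isEquivariant_flat _).transpose.submatrix_right _
  obtain ⟨L₂, hL₂e, hL₂⟩ := hKTe.exists_left_inverse hk₂'
  have hP₂ : K.submatrix ι₂ id * L₂ᵀ = 1 := by
    have := congrArg Matrix.transpose hL₂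
    rwa [transpose_mul, transpose_transpose, transpose_one] at this
  -- the chamber decomposition, with an equivariant `G`
  obtain ⟨hMG, hNG⟩ := chamber_decomposition (flat α) K (leftMat e) (rightMat e)
    ((mem_pcCode_xMatrix_iff α β e).1 he) ι₁ hι₁i (leftMat_rows e) ι₂ hι₂i (rightMat_cols e) L₁ hL₁ L₂ᵀ hP₂
  refine mem_rowSpace_zMatrix_of_chamber α β ?_ hMG hNG
  refine IsEquivariant.mul (IsEquivariant.mul (IsEquivariant.mul ?_ hL₁e) ?_) ?_
  · exact isEquivariant_one.submatrix_right _
  · exact (isEquivariant_rightMat e).submatrix_right _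
  · exact isEquivariant_one.submatrix_left _

/-! ### The cocycle half (characteristic two, by the `LP(A,B) ↔ LP(B*,A*)` symmetry) and the distance bound -/

omit [Fintype N] [DecidableEq N] [Fintype mA] [Fintype nA] [Fintype mB] [Fintype nB] [DecidableEq mA]
  [DecidableEq nA] [DecidableEq mB] [DecidableEq nB] [DecidableEq F] in
/-- Re-indexing rows and columns by bijections: `e ∈ ker (A ∘ (ρ, σ)) ↔ e ∘ σ⁻¹ ∈ ker A`. [folklore] -/
private theorem mem_pcCode_submatrix_equiv_iff {r r' q q' : Type*} [Fintype r] [Fintype r'] [Fintype q]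
    [Fintype q'] (A : Matrix r q F) (ρ : r' ≃ r) (σ : q' ≃ q) (e : q' → F) :
    e ∈ pcCode (A.submatrix ρ σ) ↔ e ∘ σ.symm ∈ pcCode A := by
  rw [mem_pcCode_iff, mem_pcCode_iff, Matrix.submatrix_mulVec_equiv]
  constructor
  · intro h; funext x; have := congrFun h (ρ.symm x); simpa using this
  · intro h; rw [h]; rfl

omit [Fintype N] [DecidableEq N] [Fintype mA] [Fintype nA] [Fintype mB] [Fintype nB] [DecidableEq mA]
  [DecidableEq nA] [DecidableEq mB] [DecidableEq nB] [DecidableEq F] in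
/-- Re-indexing rows and columns by bijections: `e ∈ rowsp (A ∘ (ρ, σ)) ↔ e ∘ σ⁻¹ ∈ rowsp A`. [folklore] -/
private theorem mem_rowSpace_submatrix_equiv_iff {r r' q q' : Type*} [Fintype r] [Fintype r'] [Fintype q]
    [Fintype q'] (A : Matrix r q F) (ρ : r' ≃ r) (σ : q' ≃ q) (e : q' → F) :
    e ∈ rowSpace (A.submatrix ρ σ) ↔ e ∘ σ.symm ∈ rowSpace A := by
  have hA : A.submatrix ρ σ = (A.submatrix ρ id).submatrix id σ := rfl
  rw [hA, mem_rowSpace_submatrix_iff, mem_rowSpace_iff, mem_rowSpace_iff]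
  constructor
  · rintro ⟨y, hy⟩
    refine ⟨y ∘ ρ.symm, ?_⟩
    rw [← hy]
    funext x
    simp only [vecMul, dotProduct, submatrix_apply, id_eq, Function.comp_apply]
    exact Fintype.sum_equiv ρ.symm _ _ fun t => by simp
  · rintro ⟨y, hy⟩
    refine ⟨y ∘ ρ, ?_⟩
    rw [← hy]
    funext x
    simp only [vecMul, dotProduct, submatrix_apply, id_eq, Function.comp_apply]
    exact Equiv.sum_comp ρ (fun t => y t * A t x)

omit [Field F] [Fintype N] [DecidableEq N] [Fintype mA] [Fintype nA] [Fintype mB] [Fintype nB] [DecidableEq mA]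
  [DecidableEq nA] [DecidableEq mB] [DecidableEq nB] [DecidableEq F] in
/-- The conjugate transpose of a matrix of circulant blocks is a matrix of circulant blocks (of the reversed
coefficient functions): `(circulant (β s u))* = circulant (t ↦ β s u (−t))` (Mathlib `transpose_circulant`).
[cite: PanteleevKalachev2022LP, §III.D (arXiv:2012.04068 chunk p0011 L3: conjugate transpose M* = (m_jiᵀ))] -/
theorem blockStar_circulant {I J : Type*} (β : I → J → N → F) :
    blockStar (fun s u => circulant (β s u)) = fun u s => circulant (fun t => β s u (-t)) := by
  funext u s
  rw [blockStar_apply, transpose_circulant]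

omit [Field F] [Fintype N] [DecidableEq N] [Fintype mA] [Fintype nA] [Fintype mB] [Fintype nB] [DecidableEq mA]
  [DecidableEq nA] [DecidableEq mB] [DecidableEq nB] [DecidableEq F] in
/-- … and its flat matrix is the transpose: `𝔅(B*) = 𝔅(B)ᵀ`. [cite: PanteleevKalachev2022LP, §III.D (arXiv:2012.04068 chunk p0011 L3: 𝔅(M*) = 𝔅(M)ᵀ)] -/
theorem flat_reverse_eq_transpose {I J : Type*} (β : I → J → N → F) :
    flat (fun u s => fun t => β s u (-t)) = (flat β)ᵀ := by
  ext ⟨u, g⟩ ⟨s, h⟩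
  simp only [flat_apply, transpose_apply, neg_sub]

/-- **The `X`-sector** (characteristic two): every vector of `ker 𝔅(H_Z) ∖ rowsp 𝔅(H_X)` has weight `w` with
`min(d(ker 𝔅(A)ᵀ), d(ker 𝔅(B)ᵀ)) ≤ c · w` — the `Z`-sector statement for `LP(B*, A*)`, which is `LP(A,B)` with
the roles of `X` and `Z` exchanged (`LiftedProductSwap.lean`).
[cite: KovalevPryadko2013Hyperbicycle, Thm 5 (arXiv:1212.6703 chunk p0011 L83–88: d ≡ min(d₁,d₂,d̃₁,d̃₂); L102–104: «Similarly, a vector v such that G_Z·v = 0 …»)]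
[cite: LinPryadko2024, Statement 12 (arXiv:2306.16400 chunk p0011 L101–110)] -/
theorem min_minDist_le_card_mul_hammingNorm_of_cocycle [CharP F 2] (α : mA → nA → N → F)
    (β : mB → nB → N → F) {e : (((nA × mB) ⊕ (mA × nB)) × N) → F}
    (he : e ∈ pcCode (zMatrix (fun i j => circulant (α i j)) (fun s u => circulant (β s u))))
    (hne : e ∉ rowSpace (xMatrix (fun i j => circulant (α i j)) (fun s u => circulant (β s u)))) :
    min (Coding.minDist (pcCode (flat α)ᵀ)) (Coding.minDist (pcCode (flat β)ᵀ)) ≤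
      ((Fintype.card N * hammingNorm e : ℕ) : ℕ∞) := by
  rw [zMatrix_eq_submatrix_xMatrix_blockStar, blockStar_circulant, blockStar_circulant,
    mem_pcCode_submatrix_equiv_iff] at he
  rw [xMatrix_eq_submatrix_zMatrix_blockStar, blockStar_circulant, blockStar_circulant,
    mem_rowSpace_submatrix_equiv_iff] at hne
  have h := min_minDist_le_card_mul_hammingNorm_of_cycle (fun u s => fun t => β s u (-t))
    (fun j i => fun t => α i j (-t)) he hne
  rwa [hammingNorm_comp_equiv, flat_reverse_eq_transpose, flat_reverse_eq_transpose, min_comm] at h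

/-- **Lin–Pryadko 2024 Statement 12 / Kovalev–Pryadko 2013 Theorem 5 for quasi-abelian lifted-product codes**
(characteristic two): with `d := min(d(ker 𝔅A), d(ker 𝔅B), d(ker 𝔅Aᵀ), d(ker 𝔅Bᵀ))` and `c := |N|`, every `D`
with `c (D − 1) < d` — in particular `D = ⌈d/c⌉` when `d < ∞` — is a lower bound for the minimum distance of
`LP(A,B)`: `D ≤ cssMinDist 𝔅(H_X) 𝔅(H_Z)`.
[cite: LinPryadko2024, Statement 12 (arXiv:2306.16400 chunk p0011 L101–110: «d_Z ≥ d₀ ≡ ⌈min(d_A^⊥,d_B^⊥)/c⌉»)]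
[cite: KovalevPryadko2013Hyperbicycle, Thm 5 (arXiv:1212.6703 chunk p0011 L83–88: «D ≥ ⌊d/c⌋, d ≡ min(d₁,d₂,d̃₁,d̃₂)»)] -/
theorem le_cssMinDist_of_card_mul_lt [CharP F 2] (α : mA → nA → N → F) (β : mB → nB → N → F) (D : ℕ)
    (hD : ((Fintype.card N * (D - 1) : ℕ) : ℕ∞) <
      min (min (Coding.minDist (pcCode (flat α))) (Coding.minDist (pcCode (flat β))))
        (min (Coding.minDist (pcCode (flat α)ᵀ)) (Coding.minDist (pcCode (flat β)ᵀ)))) :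
    (D : ℕ∞) ≤ cssMinDist (xMatrix (fun i j => circulant (α i j)) (fun s u => circulant (β s u)))
      (zMatrix (fun i j => circulant (α i j)) (fun s u => circulant (β s u))) := by
  refine le_cssMinDist_iff.2 fun e he => ?_
  have hlt : ((Fintype.card N * (D - 1) : ℕ) : ℕ∞) < ((Fintype.card N * hammingNorm e : ℕ) : ℕ∞) := by
    rcases he with ⟨hX, hZ⟩ | ⟨hZ, hX⟩
    · exact (hD.trans_le (min_le_left _ _)).trans_le (min_minDist_le_card_mul_hammingNorm_of_cycle α β hX hZ)
    · exact (hD.trans_le (min_le_right _ _)).trans_le (min_minDist_le_card_mul_hammingNorm_of_cocycle α β hZ hX)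
  have h : D - 1 < hammingNorm e := Nat.lt_of_mul_lt_mul_left (Nat.cast_lt.1 hlt)
  exact_mod_cast (show D ≤ hammingNorm e by omega)

/-! ### Lemma 16 of Lin–Pryadko (trivial quasi-abelian LP codes) — appended 2026-08-27 (qec-lit-3 g5) -/

/-- **Lin–Pryadko Lemma 16 (trivial quasi-abelian LP codes), cycle form**: «Let `A` and `B` be matrices with elements
in `R = F[N]` such that the classical codes `C_A^⊥` and `C_B^⊥` both have zero dimensions. Then the quasiabelian code
`LP[A,B]` is trivial» — here: if `ker 𝔅(A) = 0` and `ker 𝔅(B) = 0` then every `Z`-cycle of `LP(A,B)` is a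
`Z`-stabilizer (any characteristic; no transposed hypothesis is needed).
[cite: LinPryadko2024, Lemma 16 (arXiv:2306.16400 chunk p0019 L100–106)] -/
theorem pcCode_xMatrix_le_rowSpace_zMatrix_of_pcCode_eq_bot (α : mA → nA → N → F) (β : mB → nB → N → F)
    (hA : pcCode (flat α) = ⊥) (hB : pcCode (flat β) = ⊥) :
    pcCode (xMatrix (fun i j => circulant (α i j)) (fun s u => circulant (β s u))) ≤
      rowSpace (zMatrix (fun i j => circulant (α i j)) (fun s u => circulant (β s u))) := by
  intro e he
  by_contra hne
  have h := min_minDist_le_card_mul_hammingNorm_of_cycle α β he hne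
  rw [hA, hB, Coding.minDist_bot, Coding.minDist_bot, min_self, top_le_iff] at h
  exact ENat.coe_ne_top _ h

/-- **Lin–Pryadko Lemma 16 as printed: `dim LP[A,B] = 0`** when `ker 𝔅(A) = ker 𝔅(B) = 0` — for the binary CSS
code with check matrices `𝔅(H_X(A,B))`, `𝔅(H_Z(A,B))` (the tree's `CSSCode`), `k = 0`.
[cite: LinPryadko2024, Lemma 16 (arXiv:2306.16400 chunk p0019 L100–106: «the quasiabelian code LP[A,B] is trivial, dim LP[A,B] = 0»)] -/
theorem k_eq_zero_of_pcCode_eq_bot {N : Type*} [AddCommGroup N] [Fintype N] [DecidableEq N]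
    {mA nA mB nB : Type*} [Fintype mA] [Fintype nA] [Fintype mB] [Fintype nB]
    [DecidableEq mA] [DecidableEq nA] [DecidableEq mB] [DecidableEq nB]
    (α : mA → nA → N → ZMod 2) (β : mB → nB → N → ZMod 2)
    (hA : pcCode (flat α) = ⊥) (hB : pcCode (flat β) = ⊥)
    {C : CSSCode ((mA × mB) × N) ((nA × nB) × N) (((nA × mB) ⊕ (mA × nB)) × N)}
    (hX : C.HX = xMatrix (fun i j => circulant (α i j)) (fun s u => circulant (β s u)))
    (hZ : C.HZ = zMatrix (fun i j => circulant (α i j)) (fun s u => circulant (β s u))) : C.k = 0 := by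
  have hle : C.kerX ≤ C.rowSpZ := by
    rw [CSSCode.kerX, CSSCode.rowSpZ, hX, hZ]
    exact pcCode_xMatrix_le_rowSpace_zMatrix_of_pcCode_eq_bot α β hA hB
  have heq : C.kerX = C.rowSpZ := le_antisymm hle C.rowSpZ_le_kerX
  rw [← C.k_swap, CSSCode.k]
  change Module.finrank (ZMod 2) C.kerX - Module.finrank (ZMod 2) C.rowSpZ = 0
  rw [heq, Nat.sub_self]

end QuasiAbelian

/-! ### Blockwise form of the distance bound (appended 2026-08-27, qec-lit-3 g6)

The proof of Statement 12 / Theorem 5 restricts `𝔅(A)` to the columns occurring in the LEFT half of `e` and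
`𝔅(Bᵗ)` to the rows occurring in the RIGHT half, separately. Hence the sharper, blockwise conclusion used in the
proof of [KovalevPryadko2013Hyperbicycle, Thm 10] (arXiv:1212.6703 chunk p0016 L83–86: «any code word of the original
quantum code has to have support on at least one of the sublattices with weight exceeding ⌊d/c⌋»): a non-trivial
`Z`-codeword has `c · wt(left half) ≥ d(ker 𝔅(A))` OR `c · wt(right half) ≥ d(ker 𝔅(B))`. -/

section BlockWeights

variable {F : Type*} [Zero F] [DecidableEq F] {N : Type*} [Fintype N] {mA nA mB nB : Type*}

/-- Weight of the left half `(inl (j,s), g)` of a qubit vector. (definition, auxiliary)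
[cite: KovalevPryadko2013Hyperbicycle, proof of Thm 10 "support on at least one of the sublattices" (arXiv:1212.6703 chunk p0016 L83–86)] -/
def leftWt [Fintype nA] [Fintype mB] (e : (((nA × mB) ⊕ (mA × nB)) × N) → F) : ℕ :=
  hammingNorm fun p : (nA × mB) × N => e (Sum.inl p.1, p.2)

/-- Weight of the right half `(inr (i,u), g)` of a qubit vector. (definition, auxiliary)
[cite: KovalevPryadko2013Hyperbicycle, proof of Thm 10 (arXiv:1212.6703 chunk p0016 L83–86)] -/
def rightWt [Fintype mA] [Fintype nB] (e : (((nA × mB) ⊕ (mA × nB)) × N) → F) : ℕ :=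
  hammingNorm fun p : (mA × nB) × N => e (Sum.inr p.1, p.2)

/-- `wt(e) = wt(left half) + wt(right half)`. [cite: KovalevPryadko2013Hyperbicycle, proof of Thm 10 (arXiv:1212.6703 chunk p0016 L83–86)] -/
theorem leftWt_add_rightWt [Fintype mA] [Fintype nA] [Fintype mB] [Fintype nB]
    (e : (((nA × mB) ⊕ (mA × nB)) × N) → F) : leftWt e + rightWt e = hammingNorm e := by
  classical
  have h : hammingNorm e =
      hammingNorm (Sum.elim (fun p : (nA × mB) × N => e (Sum.inl p.1, p.2))
        (fun p : (mA × nB) × N => e (Sum.inr p.1, p.2))) := by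
    unfold hammingNorm
    refine Finset.card_equiv (Equiv.sumProdDistrib (nA × mB) (mA × nB) N) fun x => ?_
    rcases x with ⟨j | i, g⟩ <;> simp
  have hsplit : ∀ (x : (nA × mB) × N → F) (v : (mA × nB) × N → F),
      hammingNorm (Sum.elim x v) = hammingNorm x + hammingNorm v := by
    intro x v
    unfold hammingNorm
    rw [← Finset.card_disjSum]
    congr 1
    ext t
    rcases t with a | b <;> simp [Finset.mem_disjSum]
  rw [h, hsplit]
  rfl

end BlockWeights

section Blockwise

variable {F : Type*} [Field F] {N : Type*} [AddCommGroup N] [Fintype N] [DecidableEq N]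
variable {mA nA mB nB : Type*} [Fintype mA] [Fintype nA] [Fintype mB] [Fintype nB]
  [DecidableEq mA] [DecidableEq nA] [DecidableEq mB] [DecidableEq nB] [DecidableEq F]

omit [AddCommGroup N] [DecidableEq N] [Fintype mA] [Fintype nB] [DecidableEq mA] [DecidableEq nA] [DecidableEq mB]
  [DecidableEq nB] in
/-- At most `wt(left half)` columns of `A` occur in `e`. [cite: LinPryadko2024, §VIII.E (arXiv:2306.16400 chunk p0020 L33–36)] -/
private theorem card_leftIdx_le_leftWt (e : (((nA × mB) ⊕ (mA × nB)) × N) → F)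
    [Fintype {j : nA // ∃ s g, e (Sum.inl (j, s), g) ≠ 0}] :
    Fintype.card {j : nA // ∃ s g, e (Sum.inl (j, s), g) ≠ 0} ≤ leftWt e := by
  classical
  have hch : ∀ j : {j : nA // ∃ s g, e (Sum.inl (j, s), g) ≠ 0}, ∃ p : mB × N, e (Sum.inl (j.1, p.1), p.2) ≠ 0 :=
    fun ⟨j, s, g, h⟩ => ⟨(s, g), h⟩
  choose f hf using hch
  unfold leftWt hammingNorm
  rw [← Finset.card_univ]
  refine Finset.card_le_card_of_injOn (fun j => ((j.1, (f j).1), (f j).2)) (fun j _ => by simpa using hf j) ?_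
  rintro j - j' - h
  simp only [Prod.mk.injEq] at h
  exact Subtype.ext h.1.1

omit [AddCommGroup N] [DecidableEq N] [Fintype nA] [Fintype mB] [DecidableEq mA] [DecidableEq nA] [DecidableEq mB]
  [DecidableEq nB] in
/-- At most `wt(right half)` columns of `B` occur in `e`. [cite: LinPryadko2024, §VIII.E (arXiv:2306.16400 chunk p0020 L33–36)] -/
private theorem card_rightIdx_le_rightWt (e : (((nA × mB) ⊕ (mA × nB)) × N) → F)
    [Fintype {u : nB // ∃ i g, e (Sum.inr (i, u), g) ≠ 0}] :
    Fintype.card {u : nB // ∃ i g, e (Sum.inr (i, u), g) ≠ 0} ≤ rightWt e := by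
  classical
  have hch : ∀ u : {u : nB // ∃ i g, e (Sum.inr (i, u), g) ≠ 0}, ∃ p : mA × N, e (Sum.inr (p.1, u.1), p.2) ≠ 0 :=
    fun ⟨u, i, g, h⟩ => ⟨(i, g), h⟩
  choose f hf using hch
  unfold rightWt hammingNorm
  rw [← Finset.card_univ]
  refine Finset.card_le_card_of_injOn (fun u => (((f u).1, u.1), (f u).2)) (fun u _ => by simpa using hf u) ?_
  rintro u - u' - h
  simp only [Prod.mk.injEq] at h
  exact Subtype.ext h.1.2

/-- **The core of the proof, blockwise:** if `c · wt(left half of e) < d(ker 𝔅(A))` AND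
`c · wt(right half of e) < d(ker 𝔅(B))`, then the `Z`-codeword `e` is a `Z`-stabilizer. (Same proof as
`min_minDist_le_card_mul_hammingNorm_of_cycle`: the restricted `𝔅(A)` has an equivariant left inverse, the
restricted `𝔅(Bᵗ)` an equivariant right inverse, and the chamber decomposition produces the stabilizer.)
[cite: LinPryadko2024, Statement 12 and its proof (arXiv:2306.16400 chunk p0011 L101–110, p0020 L1–55)] [cite: KovalevPryadko2013Hyperbicycle, Thm 5 and proof (arXiv:1212.6703 chunk p0011 L83–104) and proof of Thm 10 (chunk p0016 L83–86)] -/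
theorem mem_rowSpace_zMatrix_of_card_mul_wt_lt (α : mA → nA → N → F) (β : mB → nB → N → F)
    {e : (((nA × mB) ⊕ (mA × nB)) × N) → F}
    (he : e ∈ pcCode (xMatrix (fun i j => circulant (α i j)) (fun s u => circulant (β s u))))
    (h₁ : ((Fintype.card N * leftWt e : ℕ) : ℕ∞) < Coding.minDist (pcCode (flat α)))
    (h₂ : ((Fintype.card N * rightWt e : ℕ) : ℕ∞) < Coding.minDist (pcCode (flat β))) :
    e ∈ rowSpace (zMatrix (fun i j => circulant (α i j)) (fun s u => circulant (β s u))) := by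
  classical
  -- the occurring columns
  set ι₁ : {j : nA // ∃ s g, e (Sum.inl (j, s), g) ≠ 0} × N → nA × N := Prod.map Subtype.val id with hι₁
  set ι₂ : {u : nB // ∃ i g, e (Sum.inr (i, u), g) ≠ 0} × N → nB × N := Prod.map Subtype.val id with hι₂
  have hι₁i : Function.Injective ι₁ := Subtype.val_injective.prodMap Function.injective_id
  have hι₂i : Function.Injective ι₂ := Subtype.val_injective.prodMap Function.injective_id
  have hc₁ : (Fintype.card ({j : nA // ∃ s g, e (Sum.inl (j, s), g) ≠ 0} × N) : ℕ∞) <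
      Coding.minDist (pcCode (flat α)) := by
    refine lt_of_le_of_lt ?_ h₁
    rw [Fintype.card_prod, Nat.cast_le, mul_comm]
    exact Nat.mul_le_mul_left _ (card_leftIdx_le_leftWt e)
  have hc₂ : (Fintype.card ({u : nB // ∃ i g, e (Sum.inr (i, u), g) ≠ 0} × N) : ℕ∞) <
      Coding.minDist (pcCode (flat β)) := by
    refine lt_of_le_of_lt ?_ h₂
    rw [Fintype.card_prod, Nat.cast_le, mul_comm]
    exact Nat.mul_le_mul_left _ (card_rightIdx_le_rightWt e)
  -- equivariant left inverse of the column-restricted `𝔅(A)`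
  have hk₁ := ker_submatrix_eq_bot_of_card_lt_minDist (flat α) ι₁ hι₁i hc₁
  obtain ⟨L₁, hL₁e, hL₁⟩ := ((isEquivariant_flat α).submatrix_right (Subtype.val)).exists_left_inverse hk₁
  -- equivariant right inverse of the row-restricted `𝔅(Bᵗ)`, via the transpose
  set K : Matrix (nB × N) (mB × N) F := flat (fun u s => β s u) with hK
  have hk₂ := ker_submatrix_eq_bot_of_card_lt_minDist (flat β) ι₂ hι₂i hc₂
  have hKT : (K.submatrix ι₂ id)ᵀ = ((flat β).submatrix id ι₂).submatrix
      ((Equiv.refl mB).prodCongr (Equiv.neg N))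
      ((Equiv.refl {u : nB // ∃ i g, e (Sum.inr (i, u), g) ≠ 0}).prodCongr (Equiv.neg N)) := by
    ext ⟨s, h⟩ ⟨u, g⟩
    simp only [hK, hι₂, transpose_apply, submatrix_apply, Prod.map_apply, id_eq, Equiv.prodCongr_apply,
      Equiv.coe_refl, Equiv.neg_apply, flat_apply, neg_sub_neg]
  have hk₂' : LinearMap.ker ((K.submatrix ι₂ id)ᵀ).mulVecLin = ⊥ := by
    rw [hKT]; exact ker_submatrix_equiv_eq_bot _ _ _ hk₂
  have hKTe : IsEquivariant (K.submatrix ι₂ id)ᵀ := by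
    rw [transpose_submatrix]; exact (isEquivariant_flat _).transpose.submatrix_right _
  obtain ⟨L₂, hL₂e, hL₂⟩ := hKTe.exists_left_inverse hk₂'
  have hP₂ : K.submatrix ι₂ id * L₂ᵀ = 1 := by
    have := congrArg Matrix.transpose hL₂
    rwa [transpose_mul, transpose_transpose, transpose_one] at this
  -- the chamber decomposition, with an equivariant `G`
  obtain ⟨hMG, hNG⟩ := chamber_decomposition (flat α) K (leftMat e) (rightMat e)
    ((mem_pcCode_xMatrix_iff α β e).1 he) ι₁ hι₁i (leftMat_rows e) ι₂ hι₂i (rightMat_cols e) L₁ hL₁ L₂ᵀ hP₂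
  refine mem_rowSpace_zMatrix_of_chamber α β ?_ hMG hNG
  refine IsEquivariant.mul (IsEquivariant.mul (IsEquivariant.mul ?_ hL₁e) ?_) ?_
  · exact isEquivariant_one.submatrix_right _
  · exact (isEquivariant_rightMat e).submatrix_right _
  · exact isEquivariant_one.submatrix_left _

/-- **Blockwise distance bound (`Z`-sector):** a NON-trivial `Z`-codeword `e` of the quasi-abelian `LP(A,B)` has
`d(ker 𝔅(A)) ≤ c · wt(left half)` or `d(ker 𝔅(B)) ≤ c · wt(right half)` — «support on at least one of the
sublattices with weight exceeding ⌊d/c⌋» (and hence `min(d_A, d_B) ≤ c · wt(e)`, the statement of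
`min_minDist_le_card_mul_hammingNorm_of_cycle`).
[cite: KovalevPryadko2013Hyperbicycle, proof of Thm 10 (arXiv:1212.6703 chunk p0016 L83–86) with Thm 5 (chunk p0011 L83–104)] [cite: LinPryadko2024, Statement 12 (arXiv:2306.16400 chunk p0011 L101–110)] -/
theorem minDist_le_card_mul_leftWt_or_rightWt (α : mA → nA → N → F) (β : mB → nB → N → F)
    {e : (((nA × mB) ⊕ (mA × nB)) × N) → F}
    (he : e ∈ pcCode (xMatrix (fun i j => circulant (α i j)) (fun s u => circulant (β s u))))
    (hne : e ∉ rowSpace (zMatrix (fun i j => circulant (α i j)) (fun s u => circulant (β s u)))) :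
    Coding.minDist (pcCode (flat α)) ≤ ((Fintype.card N * leftWt e : ℕ) : ℕ∞) ∨
      Coding.minDist (pcCode (flat β)) ≤ ((Fintype.card N * rightWt e : ℕ) : ℕ∞) := by
  by_contra h
  rw [not_or, not_le, not_le] at h
  exact hne (mem_rowSpace_zMatrix_of_card_mul_wt_lt α β he h.1 h.2)

end Blockwise

end LiftedProduct

end Literature.InformationTheory.QuantumCodes
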